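import Summits.RiemannHypothesis.RiemannHypothesis.Theorems.JensenLogBandArcSaddlePolar
import HarnessLib

/-!
# Curvature of the model phase at the saddle (BAND line, step S4a)

RH ladder column JENSEN, rung J-P(P3) «log band», BAND crux `XiDerivBandRealAllRates` of route
«JensenLogBand», line «band-one-window» (u-arc reshape), lead rh-jensen-prover g7 — step (S4a) of
HOME/rh-jensen-prover/g7-work/LINE-PLAN.md §7. RH-FREE (Γ-factor only). WHAT THIS IS NOT: nothing
here bears on zeros of `ζ` or the truth of RH.

Along the arc `u = c + r e^{iφ}` the logarithmic `φ`-derivative of the `ζ`-free density is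
`S_{n,c}(u)·i(u−c)`, so at the saddle `u*` (`S_{n,c}(u*) = 0`) the second `φ`-derivative of the
phase is `Φ″(φ₀) = −S′(u*)(u*−c)²`. Since `S = D − n/(u−c)` on the disc, `S′ = D′ + n/(u−c)²` and
`S′(u*)(u*−c)² = n + D′(u*)(u*−c)²`. This file proves the derivative formula
(`LogBandArc.hasDerivAt_saddleDen`, `LogBandArc.hasDerivAt_arcSaddleFn`) with the bound
`‖D′‖ ≤ 33/(4T) + 1/(0.79T)² + (n+1)/(1.79T)²`, and the **curvature bound**
`‖S′(u*)(u*−c)² − n‖ ≤ (9/20)·n` (`LogBandArc.arcSaddle_curvature_bound`): the Gaussian of the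
Laplace window (`LogBandArc.laplace_window_core`) has complex curvature `n(1 + ε)`, `|ε| ≤ 0.45`
(numerically `α ∈ [0.946, 1]`, `|β| ≤ 0.043`, LINE-PLAN §5; the slack is the crude `λ″` error
`6/Im s`, harmless once `ℓ_T` is large — LINE-PLAN §7 «constants insight»).
-/

noncomputable section

-- single-problem summit: `Summit.RiemannHypothesis.RiemannHypothesis.…` is the tree convention
set_option linter.dupNamespace false

open Complex Real

namespace Summit.RiemannHypothesis.RiemannHypothesis.Theorems.JensenPolynomials.LogBandArc

open Literature.NumberTheory.LFunctions

variable {n : ℕ} {x T : ℝ} {u : ℂ}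

/-- **Derivative of `D` on the disc** with the bound `‖D′(u)‖ ≤ 33/(4T) + 1/(0.79T)² + (n+1)/(1.79T)²`
(`λ″` from eng-2 g5's `hasDerivAt_xiGammaLogDeriv` / `norm_xiGammaLogDeriv2_sub_le_of_re_nonneg`).
[folklore] -/
theorem hasDerivAt_saddleDen (hx : |x| ≤ 1 / 2) (hT : 100 ≤ T) (hℓ : 20 ≤ ell T)
    (hn : 100 ≤ n) (hh : 1 / 2 ≤ bandRadius n T) (hhT : bandRadius n T ≤ 7 / 20 * T)
    (hu : ‖u - ((x : ℂ) + (T : ℂ) * I + bandRadius n T)‖ ≤ 3 / 5 * bandRadius n T) :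
    ∃ D' : ℂ, HasDerivAt (fun w : ℂ => saddleDen n ((x : ℂ) + (T : ℂ) * I) w) D' u ∧
      ‖D'‖ ≤ 33 / 4 / T + 1 / (79 / 100 * T) ^ 2 + ((n : ℝ) + 1) / (179 / 100 * T) ^ 2 := by
  set h := bandRadius n T with hhdef
  set ℓ := ell T with hℓdef
  set c : ℂ := (x : ℂ) + (T : ℂ) * I with hc
  set s : ℂ := 1 / 2 + u with hs
  obtain ⟨him_lo, him_hi, hre_lo, hre_hi, hns_lo, hns_hi, hnu_lo, hucim, hucre, hnuc⟩ :=
    disc_geometry hx hT hh hhT hu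
  rw [← hc] at hucim hucre hnuc
  rw [← hs] at him_lo him_hi hre_lo hre_hi hns_lo hns_hi
  have hT0 : 0 < T := by linarith
  have hhℓ : h * ℓ = 2 * ((n : ℝ) + 1) := bandRadius_mul_ell hℓ
  have him0 : 0 < s.im := him_lo.trans_lt' (by linarith)
  have hu0 : u ≠ 0 := by
    intro h0; rw [h0, norm_zero] at hnu_lo; linarith
  have huc0 : u + c ≠ 0 := by
    intro h0; rw [h0, norm_zero] at hnuc; linarith
  -- derivative of `lamPrime` at `s`
  set L : ℂ := -1 / s ^ 2 - 1 / (s - 1) ^ 2 + deriv Complex.digamma (s / 2) / 4 with hL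
  have hlam : HasDerivAt lamPrime L s := by
    unfold lamPrime; exact hasDerivAt_xiGammaLogDeriv him0
  have hlam' : HasDerivAt (fun w : ℂ => lamPrime (1 / 2 + w)) L u := by
    have hid : HasDerivAt (fun w : ℂ => (1 / 2 : ℂ) + w) 1 u := (hasDerivAt_id u).const_add _
    have hlam2 : HasDerivAt lamPrime L ((fun w : ℂ => (1 / 2 : ℂ) + w) u) := by
      simpa only [hs] using hlam
    have hcomp : HasDerivAt (fun w : ℂ => lamPrime (1 / 2 + w)) (L * 1) u :=
      HasDerivAt.comp u hlam2 hid
    rw [mul_one] at hcomp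
    exact hcomp
  have hinv : HasDerivAt (fun w : ℂ => 1 / w) (-(u ^ 2)⁻¹) u := by
    have := hasDerivAt_inv hu0
    simpa only [one_div] using this
  have hfrac : HasDerivAt (fun w : ℂ => ((n : ℂ) + 1) / (w + c)) (-(((n : ℂ) + 1) / (u + c) ^ 2)) u := by
    have h1 : HasDerivAt (fun w : ℂ => (w + c)⁻¹) (-1 / (u + c) ^ 2) u := by
      have := ((hasDerivAt_id u).add_const c).fun_inv huc0
      simpa using this
    have h2 := h1.const_mul ((n : ℂ) + 1)
    refine h2.congr_deriv ?_ |>.congr_of_eventuallyEq ?_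
    · field_simp
    · exact Filter.Eventually.of_forall fun w => by simp [div_eq_mul_inv]
  set D' : ℂ := L - (u ^ 2)⁻¹ + ((n : ℂ) + 1) / (u + c) ^ 2 with hD'
  have hDen : HasDerivAt (fun w : ℂ => saddleDen n c w) D' u := by
    have := (hlam'.add hinv).sub hfrac
    refine this.congr_deriv ?_ |>.congr_of_eventuallyEq ?_
    · rw [hD']; ring
    · exact Filter.Eventually.of_forall fun w => by simp [saddleDen]
  refine ⟨D', hDen, ?_⟩
  -- bounds: ‖L‖ ≤ 1/(2‖s‖) + 6/Im s, ‖1/u²‖, ‖(n+1)/(u+c)²‖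
  have hL2 := norm_xiGammaLogDeriv2_sub_le_of_re_nonneg (s := s) (by linarith) (by linarith)
  rw [← hL] at hL2
  have hs0 : s ≠ 0 := by intro h0; rw [h0] at him0; simp at him0
  have hLn : ‖L‖ ≤ 1 / (2 * ‖s‖) + 6 / s.im := by
    have : ‖L‖ ≤ ‖L - 1 / (2 * s)‖ + ‖1 / (2 * s)‖ := by
      have := norm_add_le (L - 1 / (2 * s)) (1 / (2 * s)); rwa [sub_add_cancel] at this
    have e : ‖1 / (2 * s)‖ = 1 / (2 * ‖s‖) := by
      rw [norm_div, norm_one, norm_mul, Complex.norm_two]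
    linarith [e]
  have hLn' : ‖L‖ ≤ 33 / 4 / T := by
    have h1 : 1 / (2 * ‖s‖) ≤ 1 / (2 * (79 / 100 * T)) :=
      one_div_le_one_div_of_le (by positivity) (by linarith)
    have h2 : 6 / s.im ≤ 6 / (79 / 100 * T) :=
      div_le_div_of_nonneg_left (by norm_num) (by positivity) him_lo
    have : 1 / (2 * (79 / 100 * T)) + 6 / (79 / 100 * T) ≤ 33 / 4 / T := by
      rw [div_add_div _ _ (by positivity) (by positivity), div_le_div_iff₀ (by positivity) hT0]
      nlinarith [hT0]
    linarith
  have hu2 : ‖(u ^ 2)⁻¹‖ ≤ 1 / (79 / 100 * T) ^ 2 := by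
    rw [norm_inv, norm_pow, ← one_div]
    exact one_div_le_one_div_of_le (by positivity) (pow_le_pow_left₀ (by positivity) hnu_lo 2)
  have huc2 : ‖((n : ℂ) + 1) / (u + c) ^ 2‖ ≤ ((n : ℝ) + 1) / (179 / 100 * T) ^ 2 := by
    rw [norm_div, norm_pow]
    have hn1 : ‖(n : ℂ) + 1‖ = (n : ℝ) + 1 := by
      rw [show ((n : ℂ) + 1) = ((n + 1 : ℕ) : ℂ) by push_cast; ring, Complex.norm_natCast]; push_cast; ring
    rw [hn1]
    exact div_le_div_of_nonneg_left (by positivity) (by positivity)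
      (pow_le_pow_left₀ (by positivity) hnuc 2)
  have hD'n : ‖D'‖ ≤ 33 / 4 / T + 1 / (79 / 100 * T) ^ 2 + ((n : ℝ) + 1) / (179 / 100 * T) ^ 2 := by
    have := norm_add₃_le (a := L) (b := -(u ^ 2)⁻¹) (c := ((n : ℂ) + 1) / (u + c) ^ 2)
    rw [norm_neg, ← sub_eq_add_neg] at this
    rw [hD']
    linarith
  exact hD'n

/-- **Derivative of the saddle function on the disc:** `S′(u) = D′(u) + n/(u−c)²`, with the same
bound on `D′`. [folklore] -/
theorem hasDerivAt_arcSaddleFn (hx : |x| ≤ 1 / 2) (hT : 100 ≤ T) (hℓ : 20 ≤ ell T)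
    (hn : 100 ≤ n) (hh : 1 / 2 ≤ bandRadius n T) (hhT : bandRadius n T ≤ 7 / 20 * T)
    (hu : ‖u - ((x : ℂ) + (T : ℂ) * I + bandRadius n T)‖ ≤ 3 / 5 * bandRadius n T) :
    ∃ D' : ℂ, HasDerivAt (arcSaddleFn n ((x : ℂ) + (T : ℂ) * I))
      (D' + (n : ℂ) / (u - ((x : ℂ) + (T : ℂ) * I)) ^ 2) u ∧
      ‖D'‖ ≤ 33 / 4 / T + 1 / (79 / 100 * T) ^ 2 + ((n : ℝ) + 1) / (179 / 100 * T) ^ 2 := by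
  set h := bandRadius n T with hhdef
  set c : ℂ := (x : ℂ) + (T : ℂ) * I with hc
  have hh0 : 0 < h := by linarith
  obtain ⟨D', hD', hb⟩ := hasDerivAt_saddleDen hx hT hℓ hn hh hhT hu
  refine ⟨D', ?_, hb⟩
  obtain ⟨him, hre⟩ := disc_coords hu
  have him' := abs_le.1 him
  have hre' := abs_le.1 hre
  have hx' := abs_le.1 hx
  -- `u − c ≠ 0` and the open conditions `Re(½+w) > 0`, `½ + w ≠ 1` near `u`
  have huc : u - c ≠ 0 := by
    intro h0
    have : (u - c).re = 0 := by rw [h0]; simp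
    simp [hc] at this
    linarith
  have hderiv_frac : HasDerivAt (fun w : ℂ => (n : ℂ) / (w - c)) (-((n : ℂ) / (u - c) ^ 2)) u := by
    have h1 : HasDerivAt (fun w : ℂ => (w - c)⁻¹) (-1 / (u - c) ^ 2) u := by
      have := ((hasDerivAt_id u).sub_const c).fun_inv huc
      simpa using this
    have h2 := h1.const_mul (n : ℂ)
    refine h2.congr_deriv ?_ |>.congr_of_eventuallyEq ?_
    · field_simp
    · exact Filter.Eventually.of_forall fun w => by simp [div_eq_mul_inv]
  have hmain := hD'.sub hderiv_frac
  have hmain' : HasDerivAt (fun w : ℂ => saddleDen n c w - (n : ℂ) / (w - c))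
      (D' + (n : ℂ) / (u - c) ^ 2) u := hmain.congr_deriv (by ring)
  refine hmain'.congr_of_eventuallyEq ?_
  -- `arcSaddleFn = saddleDen − n/(w − c)` on the open set `{Re(½+w) > 0} ∩ {½ + w ≠ 1}` ∋ u
  have hre_u : 0 < (1 / 2 + u).re := by simp; linarith
  have hopen : ∀ᶠ w in nhds u, 0 < (1 / 2 + w).re ∧ 1 / 2 + w ≠ 1 := by
    have h1 : ∀ᶠ w in nhds u, 0 < (1 / 2 + w).re :=
      (Complex.continuous_re.comp (continuous_const.add continuous_id)).continuousAt.eventually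
        (isOpen_Ioi.mem_nhds hre_u)
    have hT0 : (0 : ℝ) < T := by linarith
    have hne : (1 / 2 + u).im ≠ (1 : ℂ).im := by
      simp; intro h0; rw [h0] at him'; linarith
    have h2 : ∀ᶠ w in nhds u, 1 / 2 + w ≠ 1 := by
      have hc2 : ContinuousAt (fun w : ℂ => (1 / 2 + w).im) u :=
        (Complex.continuous_im.comp (continuous_const.add continuous_id)).continuousAt
      have := hc2.eventually (isOpen_ne.mem_nhds hne)
      filter_upwards [this] with w hw h0
      exact hw (by rw [h0])
    exact h1.and h2
  filter_upwards [hopen] with w hw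
  exact arcSaddleFn_eq_saddleDen_sub n c hw.1 hw.2

/-- **Curvature bound at the saddle (S4a):** for a zero `u*` of `S_{n,c}` in the disc,
`‖S′(u*)·(u* − c)² − n‖ ≤ (9/20)·n`, i.e. `Φ″(φ₀) = −S′(u*)(u*−c)² = −n(1 + ε)` with `|ε| ≤ 0.45`.
[folklore] -/
theorem arcSaddle_curvature_bound (hx : |x| ≤ 1 / 2) (hT : 100 ≤ T)
    (hℓ : 20 ≤ ell T) (hn : 100 ≤ n) (hh : 1 / 2 ≤ bandRadius n T)
    (hhT : bandRadius n T ≤ 7 / 20 * T)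
    (hu : ‖u - ((x : ℂ) + (T : ℂ) * I + bandRadius n T)‖ ≤ 3 / 5 * bandRadius n T)
    (hS : arcSaddleFn n ((x : ℂ) + (T : ℂ) * I) u = 0) :
    ‖deriv (arcSaddleFn n ((x : ℂ) + (T : ℂ) * I)) u * (u - ((x : ℂ) + (T : ℂ) * I)) ^ 2 - n‖ ≤
      9 / 20 * n := by
  set h := bandRadius n T with hhdef
  set ℓ := ell T with hℓdef
  set c : ℂ := (x : ℂ) + (T : ℂ) * I with hc
  have hT0 : 0 < T := by linarith
  have hℓ0 : 0 < ℓ := by linarith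
  have hhℓ : h * ℓ = 2 * ((n : ℝ) + 1) := bandRadius_mul_ell hℓ
  obtain ⟨D', hD', hb⟩ := hasDerivAt_arcSaddleFn hx hT hℓ hn hh hhT hu
  obtain ⟨hre_pos, -, -, -, hr_hi⟩ := arcSaddle_polar_bounds hx hT hℓ hn hh hhT hu hS
  have huc : u - c ≠ 0 := by
    intro h0; rw [h0] at hre_pos; simp at hre_pos
  rw [hD'.deriv]
  have e : (D' + (n : ℂ) / (u - c) ^ 2) * (u - c) ^ 2 - n = D' * (u - c) ^ 2 := by
    field_simp
    ring
  rw [e, norm_mul, norm_pow]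
  -- ‖u − c‖ ≤ (20/9)(n/ℓ) ≤ (10/9) h, so ‖u−c‖² ≤ (100/81) h² = (100/81) t² T², t = h/T ≤ 7/20
  have hnpos : (0 : ℝ) < n := by exact_mod_cast (show 0 < n by omega)
  have hn1 : (101 : ℝ) ≤ (n : ℝ) + 1 := by
    have : (100 : ℝ) ≤ n := by exact_mod_cast hn
    linarith
  have hnℓ : (n : ℝ) / ℓ ≤ h / 2 := by
    rw [div_le_iff₀ hℓ0]; nlinarith only [hhℓ, hℓ0]
  have hr : ‖u - c‖ ≤ 10 / 9 * h := by
    have : ‖u - c‖ ≤ 20 / 9 * ((n : ℝ) / ℓ) := hr_hi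
    linarith
  have hh0 : 0 < h := by linarith
  have hr2 : ‖u - c‖ ^ 2 ≤ (10 / 9 * h) ^ 2 := pow_le_pow_left₀ (norm_nonneg _) hr 2
  set t := h / T with ht
  have hht : h = t * T := by rw [ht]; field_simp
  have ht0 : 0 ≤ t := by positivity
  have ht1 : t ≤ 7 / 20 := by rw [ht, div_le_iff₀ hT0]; linarith
  have hh10 : h ≤ ((n : ℝ) + 1) / 10 := by
    have : 20 * h ≤ h * ℓ := by nlinarith only [hh0, hℓ]
    linarith
  -- the three products
  have k1 : 33 / 4 / T * (10 / 9 * h) ^ 2 ≤ 357 / 1000 * ((n : ℝ) + 1) := by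
    have e1 : 33 / 4 / T * (10 / 9 * h) ^ 2 = 3300 / 324 * t * h := by
      rw [hht]; field_simp; ring
    rw [e1]
    have : t * h ≤ 7 / 20 * h := mul_le_mul_of_nonneg_right ht1 hh0.le
    linarith
  have k2 : 1 / (79 / 100 * T) ^ 2 * (10 / 9 * h) ^ 2 ≤ 25 / 10000 * ((n : ℝ) + 1) := by
    have e1 : 1 / (79 / 100 * T) ^ 2 * (10 / 9 * h) ^ 2 = 1000000 / 505521 * t ^ 2 := by
      rw [hht]; field_simp; ring
    rw [e1]
    have : t ^ 2 ≤ (7 / 20) ^ 2 := pow_le_pow_left₀ ht0 ht1 2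
    linarith
  have k3 : ((n : ℝ) + 1) / (179 / 100 * T) ^ 2 * (10 / 9 * h) ^ 2 ≤ 48 / 1000 * ((n : ℝ) + 1) := by
    have e1 : ((n : ℝ) + 1) / (179 / 100 * T) ^ 2 * (10 / 9 * h) ^ 2 =
        1000000 / 2595321 * t ^ 2 * ((n : ℝ) + 1) := by
      rw [hht]; field_simp; ring
    rw [e1]
    have ht2 : t ^ 2 ≤ (7 / 20) ^ 2 := pow_le_pow_left₀ ht0 ht1 2
    have hn0 : (0 : ℝ) ≤ (n : ℝ) + 1 := by positivity
    have := mul_le_mul_of_nonneg_right ht2 hn0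
    linarith
  calc ‖D'‖ * ‖u - c‖ ^ 2
      ≤ (33 / 4 / T + 1 / (79 / 100 * T) ^ 2 + ((n : ℝ) + 1) / (179 / 100 * T) ^ 2) *
          (10 / 9 * h) ^ 2 :=
        mul_le_mul hb hr2 (by positivity) (by positivity)
    _ = 33 / 4 / T * (10 / 9 * h) ^ 2 + 1 / (79 / 100 * T) ^ 2 * (10 / 9 * h) ^ 2 +
          ((n : ℝ) + 1) / (179 / 100 * T) ^ 2 * (10 / 9 * h) ^ 2 := by ring
    _ ≤ 357 / 1000 * ((n : ℝ) + 1) + 25 / 10000 * ((n : ℝ) + 1) + 48 / 1000 * ((n : ℝ) + 1) := by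
        linarith [k1, k2, k3]
    _ ≤ 9 / 20 * n := by
        have : (100 : ℝ) ≤ n := by exact_mod_cast hn
        linarith

end Summit.RiemannHypothesis.RiemannHypothesis.Theorems.JensenPolynomials.LogBandArc

end
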